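import Literature.MathematicalPhysics.QuantumFieldTheory.Balaban1983to89.B9Eq3126EnergyBallTowerPiClosed
import Literature.MathematicalPhysics.QuantumFieldTheory.Balaban1983to89.B7Eq43AveragedSmallnessLinearFeed

/-!
# `Balaban1983to89.B9Eq3126EnergyBallTowerPiTwoWindows` — T. Bałaban, *Propagators for lattice gauge theories in a background field*, Commun. Math. Phys. **99**
# (1985) 389–434 [Balaban1985BackgroundPropagators] (3.122) p. 420, (3.126) p. 420, (3.130) p. 421, Thm 3.13 ∕ (3.153) p. 426, Thm 3.4 p. 400, Thm 3.11 p. 416 and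
# (3.35)–(3.37) p. 396 AT `k = n+1` AVERAGING LEVELS ON PRINT's DIAGONAL `ηL^{n+1} = 1`: **THE `k`-LEVEL BALL FOR PRINT's OWN LETTERS (`G̃_k = Δ̃_{a,k}(U)⁻¹`,
# `H̃_{1,k}`, `𝔊̃_k` of the operator (3.122) `B9Eq3119DeltaPiTower.laplaceAkPi`) IN THE ENERGY CURRENCY ON PRINT's CLASS (3.35) — NO OPERATOR LETTER, NO PROFILE
# BINDER** — the row OWNER t4-ne9-p1 g88's junction `B9Eq3126EnergyBallTowerPiClosed.exists_energy_ball_pi_diagonal_closed` with the level-profile binders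
# `εU ∕ hεU ∕ hUε ∕ hεg ∕ r ∕ hUb ∕ hU1′` STRUCK by this lineage's α-LINEAR feed (`B7Eq43AveragedSmallnessLinearFeed`): the background valued in an averaging-closed
# `S ≤ U1`, unitary, bonds `αη`-close, plaquettes `αη²`-close — the OWNER g88's OFFER -I (STAGED-2, journal)

statement-level skeleton of published theorems with citation tags; proofs where landed; nothing here is a claim about the Yang–Mills mass gap

CITATION HEADER (lean-in-tree rule).  Audit cell `pub-balaban`, sub-cell `t4`, BINDER row NE9; filed by NE9 crux-team (2) leaf prover 03
(`b2b-balaban-t4-ne9-formalise-leaf-03`, gen 67), INTENT I-ne9leaf03-g67-I = the row OWNER t4-ne9-p1 g88's OFFER («the two-window twin of THIS junction is the natural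
-I, yours if you want it»), TAKEN; the same plumbing as this lineage's gen-66 `B9Eq3126EnergyBallTowerTwoWindows` for the chain's letters.  Sources READ in the held
text `paper:balaban1985-cmp99-background-propagators` (journal page = PDF page + 388) pp. 396, 400, 416, 420–421, 426.  Objects BY NAME: `laplaceAkPi`, `laplaceAk`,
`laplacePrimeAk`, `QkW`, `RofUk`, `hessOp`; `greenK`, `G1LatticeK`, `H1LatticeK`, `frakGLatticeK`, `covCurlL2K`, `covDivL2K`; nothing re-declared, 0 `def`.

THE PRINT (verbatim).  p. 400, Thm 3.4: *«… describing these analytic extensions as small perturbations of the operators depending on U only»*; p. 420: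
*«HB = GQ*(QGQ*)⁻¹B (3.126) … we will prove that this term is a small perturbation of Δ_a, and that the operator G used in the above formula has all the
properties formulated in Theorems 3.3, 3.10, 3.11»*; p. 426: *«(3.147), (3.153) permit us to reduce properties of 𝔓, 𝔊 to the corresponding properties of
G′, (Q′G′²Q′*)⁻¹, G₁, (QG₁Q*)⁻¹ … Theorem 3.13»*; p. 396 (3.35): bonds `αη`, plaquettes `αη²`.

WHY THIS FILE (cell context).  The Δ_π port (OWNER g87 plan v7): the object O-NE9-1 #5 must identify with Bałaban's 𝐇_k is PRINT's operator (3.122), not the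
`G₀`-proxy; its letters satisfy `Q𝔊 = 0`, `RD*𝔊 = 0` (`B9Eq3119DeltaPiTower`).  The OWNER g88's junction assembles the k-level energy ball for these letters on the
diagonal with a level profile; this file is its consumer-facing form on print's class (3.35) — the shape in which the k-level chart is re-instantiated at
`laplaceAkPi` (Support, INTERFACE REQUEST only).

WHAT IS PROVED (sorry-free; proof lane — 0 `def`; [folklore] binder plumbing over landed files).
* **`exists_energy_ball_pi_twoWindows`** — `∃ α₀ C > 0` (closed in `(d, a, a′, L, M_φ, M_φ′, C_τ, ρ_w)`; `C = K·C^{junction}(r = 1∕L)`, `K = 1 + 512(d+1)(d+4)`)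
  BEFORE `∀ n η (ηL^{n+1} = 1) (3 ≤ L^{n+1}) c₀ c₁ (c₀(L^{n+1})^d = c₁) (|η|^d∕c₀ ≤ ρ_w) m U (E162's data) S (AvgClosed) (U(b) ∈ S) α (0 ≤ α ≤ α₀) (U(b)* = U(b)⁻¹)
  (‖U(b) − 1‖ ≤ αη) (‖U(∂p) − 1‖ ≤ αη²)`, ANY `hpos′` (positivity of `Δ′_{a′,k}(U)`), `hpos₁` (of PRINT's `laplaceAkPi … U …`), `hpos1` (of the chain at `1`, canonical
  flat data), `hQU`, `hQ1`: the junction's four blocks VERBATIM — [G̃] `‖G̃_k(U)y‖` + rows `≤ C‖y‖` and `‖G̃_k(U)y − G_k(1)y‖` + rows `≤ Cα‖y‖`; [H̃QG̃] the three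
  rows of `H̃_kQ_kG̃_ky` `≤ C‖y‖`; [𝔊̃] `‖𝔊̃_k(U)x‖` + rows `≤ C‖x‖` and `‖𝔊̃_k(U)x − 𝔊_k(1)x‖` + rows `≤ Cα‖x‖`; [H̃] `‖H̃_k(U)b‖` + rows `≤ C‖b‖` and
  `‖H̃_k(U)b − H_k(1)b‖` + rows `≤ Cα‖b‖` (flat reference letters = the chain's at `1`, written out as in the host; they ARE print's at `1` by
  `B9Eq3119DeltaPiTowerFlat.letters_laplaceAkPi_one`, not imported).
HONEST SCOPE.  [folklore]; FIRST order at the flat point on the diagonal ONLY; the two WINDOWS, unitarity, E162's data, the trace letters, `ρ_w`, `1 ≤ d`,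
`3 ≤ L^{n+1}`, `hpos′` and the four witnesses stay HYPOTHESES (theorems on the class: `B9Eq3120DeltaPiPrimeFormTwoWindows` §3 for `hpos₁`); the fine-bond window is
NOT derived from plaquettes; no kernel bound, no decay, NOT the (N)-reading (print's Thm 3.13 decay is the chart consumer's substrate); «NE9 ⇐ the named binders»;
NE9 NOT PRINTED ∕ NOT PROVED; NOT summit progress (cell pub-balaban: row NE9 WALLED ON A MODEL (O-NE9-1; #5 UNRULED); spine PROVED 0/9; rung (B)+1 finite T⁴ — NOT
infinite volume, NOT mass gap, NOT BetaPertH, NOT Clay; HONEST DEPENDENCY: continuum YM on T⁴ ⇐ BetaPertH ∧ nine spine estimates (0/9 proved); BetaPertH ⇐ (D1) ∧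
(D4) ∧ CAP+tail; G-an2-4 gates asym, D1 and NE2/3/4).  NEW file; nothing modified.  Net new unproved facts: 0.
-/

noncomputable section

open scoped InnerProductSpace ComplexConjugate BigOperators

namespace Literature.MathematicalPhysics.QuantumFieldTheory.Balaban1983to89.B9Eq3126EnergyBallTowerPiTwoWindows

open B4Sect5Torus (TSite)
open B9SectCLatticeCarrier (Bond)
open B11Eq103H1Complex (SiteL2K BondL2K covDivL2K greenK G1LatticeK H1LatticeK frakGLatticeK)
open B9Eq310HessianOperator (adTransportW hessOp covCurlL2K)
open B9Eq310DeltaPrime (plaqHolU)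
open B9Eq315QTorus (perCfg cornerSite)
open B9Eq315QTower (towerP UlevOf)
open B9Eq315QTowerFlat (perCfg_UlevOf_one_mem_U1 norm_Wcx_UlevOf_one_sub_one_le)
open B9Eq326OperatorTower (laplaceAk QkW RofUk)
open B9Eq324DeltaPrimeATower (laplacePrimeAk)
open B9Eq3119DeltaPiTower (laplaceAkPi)
open B7Prop1Explicit (U1 Wcx boxVec)
open B7Prop2Explicit (AvgClosed)
open B9Eq3126EnergyBallTowerPiClosed (exists_energy_ball_pi_diagonal_closed)
open B7Eq43AveragedSmallnessLinearFeed (twoWindows_linear_feed)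

variable {d : ℕ} (hd : 1 ≤ d) (L : ℕ) [NeZero L] (hL : 1 ≤ L) (hL2 : 2 ≤ L)
  {𝔸 : Type*} [NormedRing 𝔸] [NormedAlgebra ℂ 𝔸] [CompleteSpace 𝔸] [NormOneClass 𝔸] [StarRing 𝔸] [NormedStarGroup 𝔸] [StarModule ℂ 𝔸]
  {W : Type*} [NormedAddCommGroup W] [InnerProductSpace ℂ W] [FiniteDimensional ℂ W] (φ : W ≃ₗ[ℂ] 𝔸)
  {Mφ Mφ' : ℝ} (hMφ : 0 ≤ Mφ) (hMφ' : 0 ≤ Mφ') (hφ : ∀ w, ‖φ w‖ ≤ Mφ * ‖w‖) (hφ' : ∀ X, ‖φ.symm X‖ ≤ Mφ' * ‖X‖)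
  {a : ℝ} (ha : 0 < a) {a' : ℝ} (ha' : 0 < a') (τ : 𝔸 →ₗ[ℂ] ℂ) {Cτ : ℝ} (hτ : ∀ X, ‖τ X‖ ≤ Cτ * ‖X‖) (hCτ : 0 ≤ Cτ) {ρw : ℝ} (hρw : 0 ≤ ρw)
  (hτ₁ : ∀ X : 𝔸, τ (star X) = conj (τ X)) (hτ₂ : ∀ X Y : 𝔸, τ (X * Y) = τ (Y * X))
  (hφτ : ∀ X Y : 𝔸, ⟪φ.symm X, φ.symm Y⟫_ℂ = τ (star X * Y))

include hd hL2 hMφ hMφ' hφ hφ' ha ha' hτ hCτ hρw hτ₁ hτ₂ hφτ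

set_option maxRecDepth 8192 in
set_option maxHeartbeats 800000 in
/-- **THE `k`-LEVEL BALL FOR PRINT's LETTERS IN THE ENERGY CURRENCY ON PRINT's CLASS (3.35) — NO OPERATOR LETTER, NO PROFILE BINDER**: there are `α₀, C > 0`
(closed in `(d, a, a′, L, M_φ, M_φ′, C_τ, ρ_w)`) such that for every `n` with `3 ≤ L^{n+1}`, `η` (`ηL^{n+1} = 1`), `c₀, c₁` (`c₀(L^{n+1})^d = c₁`, `|η|^d∕c₀ ≤ ρ_w`),
`m`, background `U` of E162's data valued in an averaging-closed `S`, `0 ≤ α ≤ α₀`, unitary, in the two windows `‖U(b) − 1‖ ≤ αη`, `‖U(∂p) − 1‖ ≤ αη²`, and ANY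
witnesses `hpos′ hpos₁ hpos1 hQU hQ1`: [G̃] bounds and flat-point Lipschitz rows of print's `G̃_k`, [H̃QG̃] rows of `H̃_kQ_kG̃_k`, [𝔊̃] bounds and Lipschitz rows of
`𝔊̃_k`, [H̃] bounds and Lipschitz rows of `H̃_{1,k}`, all in the flat energy norm — the OWNER g88's `exists_energy_ball_pi_diagonal_closed` at `r = 1∕L`, fed at
`β = Kα` by `twoWindows_linear_feed` (bounds: `C ≤ KC`; Lipschitz rows: `C·(Kα) = (KC)·α`). [cite: Balaban1985BackgroundPropagators, (3.122) p.420, (3.126) p.420, (3.130) p.421, Thm 3.4 p.400, Thm 3.11 p.416, Thm 3.13 p.426, (3.153) p.426, (3.35)–(3.37) p.396; Balaban1985Variational, (45)–(46) p.285, (110)–(111) p.294; Balaban1985Averaging, Prop. 2 (52)–(54) p.26] -/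
theorem exists_energy_ball_pi_twoWindows :
    ∃ α₀ C : ℝ, 0 < α₀ ∧ 0 < C ∧ ∀ (n : ℕ) (η : ℝ), η * (L : ℝ) ^ (n + 1) = 1 → 3 ≤ L ^ (n + 1) →
      ∀ (c₀ c₁ : ℝ) [Fact (0 < c₀)] [Fact (0 < c₁)], c₀ * ((L : ℝ) ^ (n + 1)) ^ d = c₁ → |η| ^ d / c₀ ≤ ρw →
      ∀ (m : Fin d → ℕ) [∀ i, NeZero (m i)] (U : Bond d (towerP L m (n + 1)) → 𝔸ˣ) (αU : ℕ → ℝ) (hα1 : ∀ j, αU j ≤ 1 / 64)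
        (hU1 : ∀ (j : ℕ) (x : B7Prop1Explicit.Site d) (κ : Fin d), perCfg (towerP L m (j + 1)) (UlevOf L m (n + 1) U j) x κ ∈ U1 𝔸)
        (hreg : ∀ (j : ℕ) (y : TSite d (towerP L m j)) (κ : Fin d) (r : Fin d → Fin L),
          ‖((Wcx L (perCfg (towerP L m (j + 1)) (UlevOf L m (n + 1) U j)) (cornerSite L y) κ (boxVec L r) : 𝔸ˣ) : 𝔸) - 1‖ ≤ αU j)
        {S : Subgroup 𝔸ˣ}, AvgClosed d L S → (∀ b, U b ∈ S) →
      ∀ {α : ℝ}, 0 ≤ α → α ≤ α₀ →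
        (∀ b, star (U b : 𝔸) = (((U b)⁻¹ : 𝔸ˣ) : 𝔸)) →
        (∀ b, ‖(U b : 𝔸) - 1‖ ≤ α * η) →
        (∀ p : B9SectCLatticeCarrier.Plaq d (towerP L m (n + 1)), ‖(plaqHolU U p : 𝔸) - 1‖ ≤ α * η ^ 2) →
        ∀ (hpos' : ∀ x : SiteL2K ℂ d (towerP L m (n + 1)) c₀ W, x ≠ 0 → 0 < RCLike.re ⟪x, laplacePrimeAk L m n φ η U a' (c₁ := c₁) x⟫_ℂ)
          (hpos₁ : ∀ x : BondL2K ℂ d (towerP L m (n + 1)) c₀ W, x ≠ 0 →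
            0 < RCLike.re ⟪x, laplaceAkPi L m n φ τ η U a' hpos' hL αU hα1 hU1 hreg (c₁ := c₁) a x⟫_ℂ)
          (hpos1 : ∀ x : BondL2K ℂ d (towerP L m (n + 1)) c₀ W, x ≠ 0 →
            0 < RCLike.re ⟪x, laplaceAk L m n φ η (fun _ : Bond d (towerP L m (n + 1)) => (1 : 𝔸ˣ)) hL (fun _ => 0) (fun _ => by norm_num)
              (perCfg_UlevOf_one_mem_U1 L m (n + 1)) (norm_Wcx_UlevOf_one_sub_one_le L m (n + 1) (fun _ => 0) (fun _ => le_rfl)) τ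
              (c₀ := c₀) (c₁ := c₁) a x⟫_ℂ)
          (hQU : Function.Surjective (QkW L m n φ U hL αU hα1 hU1 hreg (c₀ := c₀) (c₁ := c₁)))
          (hQ1 : Function.Surjective (QkW L m n φ (fun _ : Bond d (towerP L m (n + 1)) => (1 : 𝔸ˣ)) hL (fun _ => 0) (fun _ => by norm_num)
            (perCfg_UlevOf_one_mem_U1 L m (n + 1)) (norm_Wcx_UlevOf_one_sub_one_le L m (n + 1) (fun _ => 0) (fun _ => le_rfl)) (c₀ := c₀) (c₁ := c₁))),
        -- [G̃] print's Green's function `G̃_k(U) = (Δ̃_{a,k}(U))⁻¹`: bounds and Lipschitz rows at the flat point (flat reference: the chain's `G_k(1)`)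
        (∀ y : BondL2K ℂ d (towerP L m (n + 1)) c₀ W,
          ‖G1LatticeK hpos₁ y‖ ≤ C * ‖y‖ ∧
          ‖covCurlL2K ℂ c₀ ((η : ℂ))⁻¹ (adTransportW φ (fun _ : Bond d (towerP L m (n + 1)) => (1 : 𝔸ˣ)))
            (G1LatticeK hpos₁ y)‖ ≤ C * ‖y‖ ∧
          ‖covDivL2K ℂ c₀ ((η : ℂ))⁻¹ (adTransportW φ fun _ : Bond d (towerP L m (n + 1)) => (1 : 𝔸ˣ)⁻¹)
            (G1LatticeK hpos₁ y)‖ ≤ C * ‖y‖ ∧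
          ‖G1LatticeK hpos₁ y -
            greenK (laplaceAk L m n φ η (fun _ : Bond d (towerP L m (n + 1)) => (1 : 𝔸ˣ)) hL (fun _ => 0) (fun _ => by norm_num)
              (perCfg_UlevOf_one_mem_U1 L m (n + 1)) (norm_Wcx_UlevOf_one_sub_one_le L m (n + 1) (fun _ => 0) (fun _ => le_rfl)) τ
              (c₀ := c₀) (c₁ := c₁) a) hpos1 y‖ ≤ C * α * ‖y‖ ∧
          ‖covCurlL2K ℂ c₀ ((η : ℂ))⁻¹ (adTransportW φ (fun _ : Bond d (towerP L m (n + 1)) => (1 : 𝔸ˣ)))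
            (G1LatticeK hpos₁ y -
            greenK (laplaceAk L m n φ η (fun _ : Bond d (towerP L m (n + 1)) => (1 : 𝔸ˣ)) hL (fun _ => 0) (fun _ => by norm_num)
              (perCfg_UlevOf_one_mem_U1 L m (n + 1)) (norm_Wcx_UlevOf_one_sub_one_le L m (n + 1) (fun _ => 0) (fun _ => le_rfl)) τ
              (c₀ := c₀) (c₁ := c₁) a) hpos1 y)‖ ≤ C * α * ‖y‖ ∧
          ‖covDivL2K ℂ c₀ ((η : ℂ))⁻¹ (adTransportW φ fun _ : Bond d (towerP L m (n + 1)) => (1 : 𝔸ˣ)⁻¹)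
            (G1LatticeK hpos₁ y -
            greenK (laplaceAk L m n φ η (fun _ : Bond d (towerP L m (n + 1)) => (1 : 𝔸ˣ)) hL (fun _ => 0) (fun _ => by norm_num)
              (perCfg_UlevOf_one_mem_U1 L m (n + 1)) (norm_Wcx_UlevOf_one_sub_one_le L m (n + 1) (fun _ => 0) (fun _ => le_rfl)) τ
              (c₀ := c₀) (c₁ := c₁) a) hpos1 y)‖ ≤ C * α * ‖y‖) ∧
        -- [H̃QG̃] the middle piece of (3.153) for print's letters: rows of `H̃_k(U)Q_k(U)G̃_k(U)`
        (∀ y : BondL2K ℂ d (towerP L m (n + 1)) c₀ W,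
          ‖H1LatticeK hpos₁ hQU (QkW L m n φ U hL αU hα1 hU1 hreg (c₁ := c₁) (G1LatticeK hpos₁ y))‖ ≤ C * ‖y‖ ∧
          ‖covCurlL2K ℂ c₀ ((η : ℂ))⁻¹ (adTransportW φ (fun _ : Bond d (towerP L m (n + 1)) => (1 : 𝔸ˣ)))
              (H1LatticeK hpos₁ hQU (QkW L m n φ U hL αU hα1 hU1 hreg (c₁ := c₁) (G1LatticeK hpos₁ y)))‖ ≤ C * ‖y‖ ∧
          ‖covDivL2K ℂ c₀ ((η : ℂ))⁻¹ (adTransportW φ fun _ : Bond d (towerP L m (n + 1)) => (1 : 𝔸ˣ)⁻¹)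
              (H1LatticeK hpos₁ hQU (QkW L m n φ U hL αU hα1 hU1 hreg (c₁ := c₁) (G1LatticeK hpos₁ y)))‖ ≤ C * ‖y‖) ∧
        -- [𝔊̃] print's third Green's letter `𝔊̃_k(U)` (3.153): bounds and Lipschitz rows at the flat point (flat reference: the chain's `𝔊_k(1)`)
        (∀ x : BondL2K ℂ d (towerP L m (n + 1)) c₀ W,
          ‖frakGLatticeK hpos₁ hQU x‖ ≤ C * ‖x‖ ∧
          ‖covCurlL2K ℂ c₀ ((η : ℂ))⁻¹ (adTransportW φ (fun _ : Bond d (towerP L m (n + 1)) => (1 : 𝔸ˣ))) (frakGLatticeK hpos₁ hQU x)‖ ≤ C * ‖x‖ ∧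
          ‖covDivL2K ℂ c₀ ((η : ℂ))⁻¹ (adTransportW φ fun _ : Bond d (towerP L m (n + 1)) => (1 : 𝔸ˣ)⁻¹) (frakGLatticeK hpos₁ hQU x)‖ ≤ C * ‖x‖ ∧
          ‖frakGLatticeK hpos₁ hQU x - frakGLatticeK (c := ((η : ℂ))⁻¹) (R := adTransportW φ (fun _ : Bond d (towerP L m (n + 1)) => (1 : 𝔸ˣ)))
              (S := adTransportW φ fun _ : Bond d (towerP L m (n + 1)) => (1 : 𝔸ˣ)⁻¹) (Δ₁ := hessOp φ η (fun _ : Bond d (towerP L m (n + 1)) => (1 : 𝔸ˣ)) τ)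
              (Rr := RofUk L m n φ η (fun _ : Bond d (towerP L m (n + 1)) => (1 : 𝔸ˣ)))
              (Q := (QkW L m n φ (fun _ : Bond d (towerP L m (n + 1)) => (1 : 𝔸ˣ)) hL (fun _ => 0) (fun _ => by norm_num)
            (perCfg_UlevOf_one_mem_U1 L m (n + 1)) (norm_Wcx_UlevOf_one_sub_one_le L m (n + 1) (fun _ => 0) (fun _ => le_rfl)) (c₀ := c₀) (c₁ := c₁))) (a := a) hpos1 hQ1 x‖ ≤ C * α * ‖x‖ ∧
          ‖covCurlL2K ℂ c₀ ((η : ℂ))⁻¹ (adTransportW φ (fun _ : Bond d (towerP L m (n + 1)) => (1 : 𝔸ˣ)))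
            (frakGLatticeK hpos₁ hQU x - frakGLatticeK (c := ((η : ℂ))⁻¹) (R := adTransportW φ (fun _ : Bond d (towerP L m (n + 1)) => (1 : 𝔸ˣ)))
              (S := adTransportW φ fun _ : Bond d (towerP L m (n + 1)) => (1 : 𝔸ˣ)⁻¹) (Δ₁ := hessOp φ η (fun _ : Bond d (towerP L m (n + 1)) => (1 : 𝔸ˣ)) τ)
              (Rr := RofUk L m n φ η (fun _ : Bond d (towerP L m (n + 1)) => (1 : 𝔸ˣ)))
              (Q := (QkW L m n φ (fun _ : Bond d (towerP L m (n + 1)) => (1 : 𝔸ˣ)) hL (fun _ => 0) (fun _ => by norm_num)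
            (perCfg_UlevOf_one_mem_U1 L m (n + 1)) (norm_Wcx_UlevOf_one_sub_one_le L m (n + 1) (fun _ => 0) (fun _ => le_rfl)) (c₀ := c₀) (c₁ := c₁))) (a := a) hpos1 hQ1 x)‖ ≤ C * α * ‖x‖ ∧
          ‖covDivL2K ℂ c₀ ((η : ℂ))⁻¹ (adTransportW φ fun _ : Bond d (towerP L m (n + 1)) => (1 : 𝔸ˣ)⁻¹)
            (frakGLatticeK hpos₁ hQU x - frakGLatticeK (c := ((η : ℂ))⁻¹) (R := adTransportW φ (fun _ : Bond d (towerP L m (n + 1)) => (1 : 𝔸ˣ)))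
              (S := adTransportW φ fun _ : Bond d (towerP L m (n + 1)) => (1 : 𝔸ˣ)⁻¹) (Δ₁ := hessOp φ η (fun _ : Bond d (towerP L m (n + 1)) => (1 : 𝔸ˣ)) τ)
              (Rr := RofUk L m n φ η (fun _ : Bond d (towerP L m (n + 1)) => (1 : 𝔸ˣ)))
              (Q := (QkW L m n φ (fun _ : Bond d (towerP L m (n + 1)) => (1 : 𝔸ˣ)) hL (fun _ => 0) (fun _ => by norm_num)
            (perCfg_UlevOf_one_mem_U1 L m (n + 1)) (norm_Wcx_UlevOf_one_sub_one_le L m (n + 1) (fun _ => 0) (fun _ => le_rfl)) (c₀ := c₀) (c₁ := c₁))) (a := a) hpos1 hQ1 x)‖ ≤ C * α * ‖x‖) ∧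
        -- [H̃] print's minimiser `H̃_k(U) = G̃Q*(QG̃Q*)⁻¹` (3.126): bounds and Lipschitz rows at the flat point (flat reference: the chain's `H_k(1)`)
        (∀ b : BondL2K ℂ d m c₁ W,
          ‖H1LatticeK hpos₁ hQU b‖ ≤ C * ‖b‖ ∧
          ‖covCurlL2K ℂ c₀ ((η : ℂ))⁻¹ (adTransportW φ (fun _ : Bond d (towerP L m (n + 1)) => (1 : 𝔸ˣ))) (H1LatticeK hpos₁ hQU b)‖ ≤ C * ‖b‖ ∧
          ‖covDivL2K ℂ c₀ ((η : ℂ))⁻¹ (adTransportW φ fun _ : Bond d (towerP L m (n + 1)) => (1 : 𝔸ˣ)⁻¹) (H1LatticeK hpos₁ hQU b)‖ ≤ C * ‖b‖ ∧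
          ‖H1LatticeK hpos₁ hQU b - H1LatticeK (c := ((η : ℂ))⁻¹) (R := adTransportW φ (fun _ : Bond d (towerP L m (n + 1)) => (1 : 𝔸ˣ)))
              (S := adTransportW φ fun _ : Bond d (towerP L m (n + 1)) => (1 : 𝔸ˣ)⁻¹) (Δ₁ := hessOp φ η (fun _ : Bond d (towerP L m (n + 1)) => (1 : 𝔸ˣ)) τ)
              (Rr := RofUk L m n φ η (fun _ : Bond d (towerP L m (n + 1)) => (1 : 𝔸ˣ)))
              (Q := (QkW L m n φ (fun _ : Bond d (towerP L m (n + 1)) => (1 : 𝔸ˣ)) hL (fun _ => 0) (fun _ => by norm_num)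
            (perCfg_UlevOf_one_mem_U1 L m (n + 1)) (norm_Wcx_UlevOf_one_sub_one_le L m (n + 1) (fun _ => 0) (fun _ => le_rfl)) (c₀ := c₀) (c₁ := c₁))) (a := a) hpos1 hQ1 b‖ ≤ C * α * ‖b‖ ∧
          ‖covCurlL2K ℂ c₀ ((η : ℂ))⁻¹ (adTransportW φ (fun _ : Bond d (towerP L m (n + 1)) => (1 : 𝔸ˣ)))
            (H1LatticeK hpos₁ hQU b - H1LatticeK (c := ((η : ℂ))⁻¹) (R := adTransportW φ (fun _ : Bond d (towerP L m (n + 1)) => (1 : 𝔸ˣ)))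
              (S := adTransportW φ fun _ : Bond d (towerP L m (n + 1)) => (1 : 𝔸ˣ)⁻¹) (Δ₁ := hessOp φ η (fun _ : Bond d (towerP L m (n + 1)) => (1 : 𝔸ˣ)) τ)
              (Rr := RofUk L m n φ η (fun _ : Bond d (towerP L m (n + 1)) => (1 : 𝔸ˣ)))
              (Q := (QkW L m n φ (fun _ : Bond d (towerP L m (n + 1)) => (1 : 𝔸ˣ)) hL (fun _ => 0) (fun _ => by norm_num)
            (perCfg_UlevOf_one_mem_U1 L m (n + 1)) (norm_Wcx_UlevOf_one_sub_one_le L m (n + 1) (fun _ => 0) (fun _ => le_rfl)) (c₀ := c₀) (c₁ := c₁))) (a := a) hpos1 hQ1 b)‖ ≤ C * α * ‖b‖ ∧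
          ‖covDivL2K ℂ c₀ ((η : ℂ))⁻¹ (adTransportW φ fun _ : Bond d (towerP L m (n + 1)) => (1 : 𝔸ˣ)⁻¹)
            (H1LatticeK hpos₁ hQU b - H1LatticeK (c := ((η : ℂ))⁻¹) (R := adTransportW φ (fun _ : Bond d (towerP L m (n + 1)) => (1 : 𝔸ˣ)))
              (S := adTransportW φ fun _ : Bond d (towerP L m (n + 1)) => (1 : 𝔸ˣ)⁻¹) (Δ₁ := hessOp φ η (fun _ : Bond d (towerP L m (n + 1)) => (1 : 𝔸ˣ)) τ)
              (Rr := RofUk L m n φ η (fun _ : Bond d (towerP L m (n + 1)) => (1 : 𝔸ˣ)))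
              (Q := (QkW L m n φ (fun _ : Bond d (towerP L m (n + 1)) => (1 : 𝔸ˣ)) hL (fun _ => 0) (fun _ => by norm_num)
            (perCfg_UlevOf_one_mem_U1 L m (n + 1)) (norm_Wcx_UlevOf_one_sub_one_le L m (n + 1) (fun _ => 0) (fun _ => le_rfl)) (c₀ := c₀) (c₁ := c₁))) (a := a) hpos1 hQ1 b)‖ ≤ C * α * ‖b‖) := by
  have hL0 : (0 : ℝ) < L := by exact_mod_cast lt_of_lt_of_le (by norm_num) hL2
  have hr0 : (0 : ℝ) ≤ 1 / (L : ℝ) := by positivity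
  have hr1 : 1 / (L : ℝ) < 1 := by rw [div_lt_one hL0]; exact_mod_cast lt_of_lt_of_le (by norm_num) hL2
  -- the OWNER g88's junction for print's letters at `r = 1∕L`
  obtain ⟨α₁, C, hα₁, hC, H⟩ :=
    exists_energy_ball_pi_diagonal_closed hd L hL φ hMφ hMφ' hφ hφ' ha ha' hr0 hr1 τ hτ hCτ hρw hτ₁ hτ₂ hφτ
  -- the α-linear feed below its threshold
  obtain ⟨T, hT, F⟩ := twoWindows_linear_feed L hL2 (d := d) (𝔸 := 𝔸) hα₁
  have hK1 : (1 : ℝ) ≤ 1 + 512 * (d + 1) * (d + 4) := by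
    have h0 : (0 : ℝ) ≤ 512 * (d + 1) * (d + 4) := by positivity
    linarith
  refine ⟨T, C * (1 + 512 * (d + 1) * (d + 4)), hT, by positivity, ?_⟩
  intro n η hηL hL3 c₀ c₁ _ _ hw hρ m _ U αU hα1 hU1 hreg S hS hU α hα0 hαle hUst hUη hpl hpos' hpos₁ hpos1 hQU hQ1
  obtain ⟨hβ0, hβ1, hUb, hUη', hpl', hU1', εU, hεU, hUε, hεg⟩ := F m n hS hU hηL hα0 hαle hUη hpl
  obtain ⟨hG, hM, hF, hH⟩ :=
    H n η hηL hL3 c₀ c₁ hw hρ m U αU hα1 hU1 hreg εU hεU hUε hβ0 hβ1 hUst hUb hUη' hpl' hεg hU1' hpos' hpos₁ hpos1 hQU hQ1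
  -- bounds: `C·t ≤ (C·K)·t`; Lipschitz rows: `C·(Kα)·t = (C·K)·α·t`
  have hCK : ∀ t : ℝ, 0 ≤ t → C * t ≤ C * (1 + 512 * (d + 1) * (d + 4)) * t := fun t ht =>
    mul_le_mul_of_nonneg_right (le_mul_of_one_le_right hC.le hK1) ht
  have e : ∀ t : ℝ, C * ((1 + 512 * (d + 1) * (d + 4)) * α) * t = C * (1 + 512 * (d + 1) * (d + 4)) * α * t := fun t => by ring
  refine ⟨fun y => ?_, fun y => ?_, fun x => ?_, fun b => ?_⟩
  · obtain ⟨h1, h2, h3, h4, h5, h6⟩ := hG y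
    exact ⟨h1.trans (hCK _ (norm_nonneg _)), h2.trans (hCK _ (norm_nonneg _)), h3.trans (hCK _ (norm_nonneg _)),
      h4.trans_eq (e _), h5.trans_eq (e _), h6.trans_eq (e _)⟩
  · obtain ⟨h1, h2, h3⟩ := hM y
    exact ⟨h1.trans (hCK _ (norm_nonneg _)), h2.trans (hCK _ (norm_nonneg _)), h3.trans (hCK _ (norm_nonneg _))⟩
  · obtain ⟨h1, h2, h3, h4, h5, h6⟩ := hF x
    exact ⟨h1.trans (hCK _ (norm_nonneg _)), h2.trans (hCK _ (norm_nonneg _)), h3.trans (hCK _ (norm_nonneg _)),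
      h4.trans_eq (e _), h5.trans_eq (e _), h6.trans_eq (e _)⟩
  · obtain ⟨h1, h2, h3, h4, h5, h6⟩ := hH b
    exact ⟨h1.trans (hCK _ (norm_nonneg _)), h2.trans (hCK _ (norm_nonneg _)), h3.trans (hCK _ (norm_nonneg _)),
      h4.trans_eq (e _), h5.trans_eq (e _), h6.trans_eq (e _)⟩

end Literature.MathematicalPhysics.QuantumFieldTheory.Balaban1983to89.B9Eq3126EnergyBallTowerPiTwoWindows

end
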